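import Mathlib
import Summits.NavierStokesRegularity.NavierStokesRegularity.Theses.GaldiLiouvilleGate
import Literature.Analysis.FluidPDE.SteadyVorticityDecayLiouville
import Literature.Analysis.FluidPDE.TaoEnstrophyLocalisation
import HarnessLib.Audit

/-!
# Crux `GaldiLiouvilleGate.CriticalRateLiouville` (stmt-NavierStokesRegularity-0897), CONDITIONALLY,
# from the named PREPRINT fact `Wu2026_critical_vorticity_liouville`

Route `GaldiLiouvilleGate` (NavierStokesRegularity), crux #6 `CriticalRateLiouville` ("Liouville at
Galdi's critical rate, arbitrary constants"): a smooth steady Navier–Stokes solution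
(`IsLerayProfile ν 0 U P`, `U, P ∈ C^∞`) with `‖U(y)‖ ≤ C⟨y⟩^{-2/3}`, `‖DU(y)‖ ≤ C⟨y⟩^{-5/3}` and
`P → 0` at infinity is `≡ 0`.

Wu, arXiv:2608.22471v1 (23 Aug 2026), Cor. 1.2 — VENDORED AS A HYPOTHESIS ONLY, the named `Prop`
`Literature.Analysis.FluidPDE.Wu2026_critical_vorticity_liouville` (file
`Literature/Analysis/FluidPDE/SteadyVorticityDecayLiouville.lean`, with its provenance flag:
preprint, unrefereed) — asserts: smooth steady NS, `U → 0` at infinity,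
`‖curl U(x)‖ ≤ C(1+‖x‖)^{-5/3}` ⇒ `U = 0`.  This file is the scaling-free DICTIONARY between the two:

* `tendsto_zero_of_norm_le_rpow_neg` — `‖U y‖ ≤ C(1+‖y‖)^{-2/3}` ⇒ `U → 0` along `cocompact`;
* `norm_curl_le_of_norm_fderiv_le` — `‖DU y‖ ≤ C(1+‖y‖)^{-5/3}` ⇒ `‖curl U y‖ ≤ (‖curlCLM‖C)(1+‖y‖)^{-5/3}`
  (the tree's `norm_curl_le`);
* `criticalRateLiouville_of_wu2026` — **`Wu2026_critical_vorticity_liouville → CriticalRateLiouville`**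
  (the pressure hypotheses of the route decl are not used).

So item 0897 is CLOSED CONDITIONALLY on one named preprint fact (D-0014: the item itself stays OPEN
until the fact is refereed or ported; the theorem below is a `proof.conditional` in the audit).
Template: the refuter's evidence `WuReduction2.lean` on the item (DIRECTOR-NS bus #40 (ii)).

WHAT THIS IS NOT: not a proof of `CriticalRateLiouville`; not an endorsement of the preprint.

## References

* W. Wu, arXiv:2608.22471v1 (2026), Cor. 1.2. [Wu2026]
* H. Kozono, Y. Terasawa, Y. Wakasugi, J. Funct. Anal. 272 (2017) 804–818. [KozonoTerasawaWakasugi2017]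
-/

noncomputable section

-- flat `Theorems/<Route><Decl>…` files share the namespace of the route (tree convention)
set_option linter.dupNamespace false

open Filter Set Metric Topology
open Literature.Analysis.FluidPDE

namespace Summit.NavierStokesRegularity.NavierStokesRegularity.Theorems.GaldiLiouvilleGate

/-- A field on `ℝ³` bounded by `C(1+‖y‖)^{-2/3}` tends to `0` at infinity (along `cocompact`).
[folklore] -/
theorem tendsto_zero_of_norm_le_rpow_neg
    {U : EuclideanSpace ℝ (Fin 3) → EuclideanSpace ℝ (Fin 3)} {C a : ℝ} (ha : 0 < a)
    (hU : ∀ y, ‖U y‖ ≤ C * (1 + ‖y‖) ^ (-a)) :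
    Tendsto U (cocompact (EuclideanSpace ℝ (Fin 3))) (𝓝 0) := by
  rw [tendsto_zero_iff_norm_tendsto_zero]
  have h1 : Tendsto (fun y : EuclideanSpace ℝ (Fin 3) => 1 + ‖y‖) (cocompact _) atTop :=
    tendsto_atTop_add_const_left _ 1 tendsto_norm_cocompact_atTop
  have h2 : Tendsto (fun y : EuclideanSpace ℝ (Fin 3) => (1 + ‖y‖) ^ (-a)) (cocompact _) (𝓝 0) :=
    (tendsto_rpow_neg_atTop ha).comp h1
  have h3 : Tendsto (fun y : EuclideanSpace ℝ (Fin 3) => |C| * (1 + ‖y‖) ^ (-a)) (cocompact _)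
      (𝓝 0) := by
    simpa using h2.const_mul |C|
  refine squeeze_zero (fun y => norm_nonneg _) (fun y => ?_) h3
  calc ‖U y‖ ≤ C * (1 + ‖y‖) ^ (-a) := hU y
    _ ≤ |C| * (1 + ‖y‖) ^ (-a) :=
        mul_le_mul_of_nonneg_right (le_abs_self C) (Real.rpow_nonneg (by positivity) _)

/-- The critical GRADIENT rate gives the critical VORTICITY rate:
`‖DU y‖ ≤ C(1+‖y‖)^{-5/3}` ⇒ `‖curl U y‖ ≤ ‖curlCLM‖·C·(1+‖y‖)^{-5/3}` (`norm_curl_le`). [folklore] -/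
theorem norm_curl_le_of_norm_fderiv_le
    {U : EuclideanSpace ℝ (Fin 3) → EuclideanSpace ℝ (Fin 3)} {C a : ℝ}
    (hDU : ∀ y, ‖fderiv ℝ U y‖ ≤ C * (1 + ‖y‖) ^ (-a)) (y : EuclideanSpace ℝ (Fin 3)) :
    ‖curl U y‖ ≤ (‖curlCLM‖ * C) * (1 + ‖y‖) ^ (-a) := by
  calc ‖curl U y‖ ≤ ‖curlCLM‖ * ‖fderiv ℝ U y‖ := norm_curl_le U y
    _ ≤ ‖curlCLM‖ * (C * (1 + ‖y‖) ^ (-a)) := by gcongr; exact hDU y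
    _ = (‖curlCLM‖ * C) * (1 + ‖y‖) ^ (-a) := by ring

/-- **Crux `CriticalRateLiouville` (item stmt-NavierStokesRegularity-0897) from Wu 2026, Cor. 1.2 —
CONDITIONAL on the named preprint fact `Wu2026_critical_vorticity_liouville`.**  Given the fact, a
smooth steady Navier–Stokes solution with `‖U(y)‖ ≤ C⟨y⟩^{-2/3}` and `‖DU(y)‖ ≤ C⟨y⟩^{-5/3}` vanishes
identically: the velocity rate gives `U → 0` at infinity (`tendsto_zero_of_norm_le_rpow_neg`) and the
gradient rate gives the critical vorticity rate (`norm_curl_le_of_norm_fderiv_le`); the smoothness of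
`P` and `P → 0` in the route decl are not needed.  The item is thereby closed CONDITIONALLY only
(the fact is an unrefereed preprint, vendored as a hypothesis). [cite: Wu2026, Cor. 1.2] -/
theorem criticalRateLiouville_of_wu2026 (hWu : Wu2026_critical_vorticity_liouville) :
    Theses.GaldiLiouvilleGate.CriticalRateLiouville := by
  intro ν hν U P hprof hU hP hrate _hPdecay
  obtain ⟨C, hC⟩ := hrate
  refine hWu ν hν U P hprof hU hP ?_ ?_
  · exact tendsto_zero_of_norm_le_rpow_neg (a := (2 / 3 : ℝ)) (by norm_num) fun y => (hC y).1
  · exact ⟨‖curlCLM‖ * C, fun y => norm_curl_le_of_norm_fderiv_le (fun z => (hC z).2) y⟩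


end Summit.NavierStokesRegularity.NavierStokesRegularity.Theorems.GaldiLiouvilleGate
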